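import Summits.Langlands.Langlands.Theorems.RationalPeriodQuarterHeckePreservesRationalPeriodsDefs

/-!
# Hecke stability of the rational period structure — part 3/4: pieces 1 and 2 proved
(crux `RationalPeriodQuarter.HeckePreservesRationalPeriods`, item stmt-Langlands-2807)

`stub_heckeCosetPermutation` (child `HeckeCosetPermutation`, registered stub signature verbatim): right
multiplication by `γ ∈ Γ₁(N)` permutes the `p + 1` cosets `Γ₁(N) M_j` — from the tree's coset representatives
`HeckeTGamma1.existsUnique_option` / `exists_X` / `mem_gamma1_of_gamma0Map_eq_one` (`M_j = ε_j diag(1,p) t_j`,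
`ε_p = σ M⁻¹ ∈ Γ₁(N)`; cover by existence, injectivity by uniqueness).
`stub_heckeStableQuarterForms` (child `HeckeStableQuarterForms`, registered stub signature verbatim): `T'_p`
preserves the quarter cusp forms on `Γ₁(N)` — `C²` by composition and sums, `Γ₁(N)`-invariance by the coset
permutation, eigenvalue `1/4` by the `GL₂⁺(ℝ)`-invariance of `Δ` (`hypLaplacian_comp_smul`), boundedness directly
(Diamond–Shurman Prop. 5.2.1 for weight-0 Maass forms).
(Provenance: part 3/4 of the verbatim re-cut of the registered, sorry-free crux line
`Summits/Langlands/Langlands/Cruxes/HeckePreservesRationalPeriods/Lines/decomposition.lean`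
(planner-cstrat-stmt-Langlands-2807-r1, 2026-08-17, sha256 41344dedc33c…; re-verified rc 0 / 0 sorry / std axioms
2026-09-01) into `Theorems/` parts of at most 400 lines; namespace moved to `Theorems.HeckeRationalPeriods`, the
route-file import confined to part 4/4.  References: Bruggeman–Lewis–Zagier, Mem. AMS 1118 (2015) (2.25), (5.4)–(5.5a);
Diamond–Shurman GTM 228 Prop. 5.2.1; Mühlenbruch, J. Number Theory 118 (2006) 208–235.)
-/

noncomputable section

set_option linter.dupNamespace false

open scoped MatrixGroups Topology ComplexConjugate
open Filter Set

namespace Summit.Langlands.Langlands.Theorems.HeckeRationalPeriods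

open Literature.NumberTheory.Automorphic UpperHalfPlane

/-! ## Piece 2 PROVED: the coset permutation from the tree's coset representatives -/

section CosetPermutationProof

open CongruenceSubgroup Matrix.SpecialLinearGroup ModularGroup
open Literature.NumberTheory.EllipticCurves.ModularForms

/-- `Fin (p+1) ≃ Option (Fin p)`: `j < p ↦ some j`, `p ↦ none`. -/
def idxEquiv (p : ℕ) : Fin (p + 1) ≃ Option (Fin p) where
  toFun k := if h : (k : ℕ) < p then some ⟨k, h⟩ else none
  invFun i := i.elim (Fin.last p) Fin.castSucc
  left_inv k := by
    by_cases h : (k : ℕ) < p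
    · simp only [h, dif_pos, Option.elim_some]
      ext; simp
    · simp only [h, dif_neg, not_false_eq_true, Option.elim_none]
      ext
      simp only [Fin.val_last]
      have := k.2
      omega
  right_inv i := by
    cases i with
    | none => simp
    | some j => simp [j.2]

/-- `idxEquiv` on indices `< p`. -/
theorem idxEquiv_of_lt {p : ℕ} {k : Fin (p + 1)} (h : (k : ℕ) < p) : idxEquiv p k = some ⟨k, h⟩ := by
  simp [idxEquiv, h]

/-- `idxEquiv` on the last index. -/
theorem idxEquiv_of_not_lt {p : ℕ} {k : Fin (p + 1)} (h : ¬ (k : ℕ) < p) : idxEquiv p k = none := by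
  simp [idxEquiv, h]

/-- The coset representatives `t_k ∈ Γ₁(N)`: `T^k` for `k < p`, the extra `X` for `k = p`.
(DiamondShurman2005, §5.2 p. 170) -/
def rep (p : ℕ) (X : SL(2, ℤ)) (k : Fin (p + 1)) : SL(2, ℤ) :=
  (idxEquiv p k).elim X fun j => T ^ ((j : ℕ) : ℤ)

/-- `diag(1, p)` as an integer matrix. -/
def Gz (p : ℕ) : Matrix (Fin 2) (Fin 2) ℤ := !![1, 0; 0, (p : ℤ)]



/-- `diag(1, p)` in `GL₂(ℝ)`. -/
theorem Gz_map (p : ℕ) : (Gz p).map (Int.cast : ℤ → ℝ) = !![(1 : ℝ), 0; 0, (p : ℝ)] := by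
  ext i j
  fin_cases i <;> fin_cases j <;> simp [Gz]

/-- `diag(1, p)` in `GL₂(ℝ)`. -/
def Ggl (p : ℕ) (hp : p.Prime) : GL (Fin 2) ℝ :=
  Matrix.GeneralLinearGroup.mkOfDetNeZero ((Gz p).map (Int.cast : ℤ → ℝ)) (by
    rw [Gz_map, Matrix.det_fin_two_of]; simp; exact_mod_cast hp.ne_zero)

/-- Underlying real matrix of `Ggl`. -/
theorem Ggl_coe (p : ℕ) (hp : p.Prime) :
    ((Ggl p hp : GL (Fin 2) ℝ) : Matrix (Fin 2) (Fin 2) ℝ) = (Gz p).map (Int.cast : ℤ → ℝ) := rfl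

/-- Underlying real matrix of `Ggl`, explicitly. -/
theorem Ggl_coe' (p : ℕ) (hp : p.Prime) :
    ((Ggl p hp : GL (Fin 2) ℝ) : Matrix (Fin 2) (Fin 2) ℝ) = !![1, 0; 0, (p : ℝ)] := by
  rw [Ggl_coe, Gz_map]

/-- From `diag(1,p) γ' t⁻¹ diag(1,p)⁻¹ ∈ Γ₁(N)` (in `GL₂(ℝ)`) to the integer identity
`diag(1,p) γ' = δ t diag… `: precisely, `∃ δ ∈ Γ₁(N)`, `Gz γ' = δ Gz t`. -/
theorem exists_delta_of_mem {N p : ℕ} (hp : p.Prime) {γ' t : SL(2, ℤ)}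
    (h : Ggl p hp * mapGL ℝ γ' * (mapGL ℝ t)⁻¹ * (Ggl p hp)⁻¹ ∈ (Gamma1 N : Subgroup (GL (Fin 2) ℝ))) :
    ∃ δ : SL(2, ℤ), δ ∈ Gamma1 N ∧
      Gz p * (γ' : Matrix (Fin 2) (Fin 2) ℤ) = (δ : Matrix (Fin 2) (Fin 2) ℤ) * (Gz p * (t : Matrix (Fin 2) (Fin 2) ℤ)) := by
  obtain ⟨δ, hδ, hδeq⟩ := h
  refine ⟨δ, hδ, ?_⟩
  have e : (mapGL ℝ δ : GL (Fin 2) ℝ) * Ggl p hp * mapGL ℝ t = Ggl p hp * mapGL ℝ γ' := by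
    rw [hδeq]; group
  have e' := congrArg (fun g : GL (Fin 2) ℝ => (g : Matrix (Fin 2) (Fin 2) ℝ)) e
  simp only [Units.val_mul, mapGL_coe_eq_map, Ggl_coe, ← map_intCast_mul] at e'
  have hinj := Matrix.map_injective (m := Fin 2) (n := Fin 2) (Int.cast_injective (α := ℝ))
  have := hinj e'
  rw [← this, Matrix.mul_assoc]

/-- **stub_heckeCosetPermutation** (registered stub of `Lines/decomposition.lean` on
stmt-Langlands-2807; child `HeckeCosetPermutation`), PROVED from the tree's coset representatives.
(DiamondShurman2005, §5.2 and Prop. 5.2.1) -/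
theorem stub_heckeCosetPermutation : ∀ N : ℕ, 0 < N → ∀ p : ℕ, p.Prime → ¬ p ∣ N → ∀ σ ∈ CongruenceSubgroup.Gamma0 N, (((σ : Matrix (Fin 2) (Fin 2) ℤ) 1 1 : ℤ) : ZMod N) = (p : ZMod N) → let M : Fin (p + 1) → Matrix (Fin 2) (Fin 2) ℤ := (fun j : Fin (p + 1) => if (j : ℕ) < p then !![(1 : ℤ), ((j : ℕ) : ℤ); 0, (p : ℤ)] else (σ : Matrix (Fin 2) (Fin 2) ℤ) * !![(p : ℤ), 0; 0, 1]); ∀ γ ∈ CongruenceSubgroup.Gamma1 N, ∃ (e : Equiv.Perm (Fin (p + 1))) (δ : Fin (p + 1) → Matrix.SpecialLinearGroup (Fin 2) ℤ), ∀ j : Fin (p + 1), δ j ∈ CongruenceSubgroup.Gamma1 N ∧ M j * (γ : Matrix (Fin 2) (Fin 2) ℤ) = (δ j : Matrix (Fin 2) (Fin 2) ℤ) * M (e j) := by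
  intro N hN p hp hpN σ hσ hσp
  show ∀ γ ∈ Gamma1 N, ∃ (e : Equiv.Perm (Fin (p + 1))) (δ : Fin (p + 1) → SL(2, ℤ)),
    ∀ j : Fin (p + 1), δ j ∈ Gamma1 N ∧
      heckeMat p σ j * (γ : Matrix (Fin 2) (Fin 2) ℤ) = (δ j : Matrix (Fin 2) (Fin 2) ℤ) * heckeMat p σ (e j)
  haveI : NeZero N := ⟨hN.ne'⟩
  -- the extra representative and the matrix `M = (m n; N p)`
  obtain ⟨X, hX10, hX11, hX00⟩ := HeckeTGamma1.exists_X N hp hpN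
  obtain ⟨m, hm⟩ := hX00
  have hXdet : X 0 0 * X 1 1 - X 0 1 * X 1 0 = 1 := by
    have := X.2; rwa [Matrix.det_fin_two] at this
  rw [hX10, hX11, hm] at hXdet
  have hMdet : !![m, X 0 1; (N : ℤ), (p : ℤ)].det = 1 := by
    rw [Matrix.det_fin_two_of]; linarith
  set M : SL(2, ℤ) := ⟨_, hMdet⟩ with hM
  have hM0 : M ∈ Gamma0 N := by simp [Gamma0_mem, hM]
  have hMp : Gamma0Map N ⟨M, hM0⟩ = (p : ZMod N) := by simp [Gamma0Map, hM]
  have hσp' : Gamma0Map N ⟨σ, hσ⟩ = (p : ZMod N) := hσp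
  -- `ε_p = σ M⁻¹ ∈ Γ₁(N)`
  have hεmem : σ * M⁻¹ ∈ Gamma1 N := by
    have : Gamma0Map N (⟨σ, hσ⟩ * (⟨M, hM0⟩ : Gamma0 N)⁻¹) = 1 := by
      rw [map_mul, hσp', ← hMp, ← map_mul, mul_inv_cancel, map_one]
    exact mem_gamma1_of_gamma0Map_eq_one N this
  -- the representatives lie in `Γ₁(N)`
  have hX1 : X ∈ Gamma1 N := HeckeTGamma1.mem_Gamma1_of_entries N hX10 hX11
  have hrep : ∀ k : Fin (p + 1), rep p X k ∈ Gamma1 N := by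
    intro k
    unfold rep
    by_cases hk : (k : ℕ) < p
    · rw [idxEquiv_of_lt hk]; exact HeckeTGamma1.T_zpow_mem_Gamma1 N _
    · rw [idxEquiv_of_not_lt hk]; exact hX1
  -- `ε_k` and the factorisation `M_k = ε_k · Gz · t_k`
  let ε : Fin (p + 1) → SL(2, ℤ) := fun k => if (k : ℕ) < p then 1 else σ * M⁻¹
  have hεΓ : ∀ k, ε k ∈ Gamma1 N := by
    intro k; by_cases hk : (k : ℕ) < p
    · simp only [ε, hk, if_true]; exact one_mem _
    · simp only [ε, hk, if_false]; exact hεmem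
  have hGX : Gz p * (X : Matrix (Fin 2) (Fin 2) ℤ) = (M : Matrix (Fin 2) (Fin 2) ℤ) * !![(p : ℤ), 0; 0, 1] := by
    ext i j
    fin_cases i <;> fin_cases j <;>
      simp [Gz, hM, Matrix.mul_apply, Fin.sum_univ_two, hm, hX10, hX11, mul_comm]
  have hfac : ∀ k : Fin (p + 1),
      heckeMat p σ k = (ε k : Matrix (Fin 2) (Fin 2) ℤ) * (Gz p * (rep p X k : Matrix (Fin 2) (Fin 2) ℤ)) := by
    intro k
    unfold heckeMat rep
    by_cases hk : (k : ℕ) < p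
    · simp only [hk, if_true, idxEquiv_of_lt hk, Option.elim_some, ε, Matrix.SpecialLinearGroup.coe_one, Matrix.one_mul, ModularGroup.coe_T_zpow, Gz]
      ext i j
      fin_cases i <;> fin_cases j <;> simp [Matrix.mul_apply, Fin.sum_univ_two]
    · simp only [hk, if_false, idxEquiv_of_not_lt hk, Option.elim_none, ε]
      rw [hGX, ← Matrix.mul_assoc, Matrix.SpecialLinearGroup.coe_mul]
      congr 1
      have hMM : ((M⁻¹ : SL(2, ℤ)) : Matrix (Fin 2) (Fin 2) ℤ) * (M : Matrix (Fin 2) (Fin 2) ℤ) = 1 := by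
        rw [← Matrix.SpecialLinearGroup.coe_mul, inv_mul_cancel, Matrix.SpecialLinearGroup.coe_one]
      rw [Matrix.mul_assoc, hMM, Matrix.mul_one]
  -- the tree's unique-coset statement, transported to the index type `Fin (p+1)`
  have hG : ((Ggl p hp : GL (Fin 2) ℝ) : Matrix (Fin 2) (Fin 2) ℝ) = !![1, 0; 0, (p : ℝ)] := Ggl_coe' p hp
  have hX00' : (p : ℤ) ∣ X 0 0 := ⟨m, hm⟩
  have hEU : ∀ γ' : SL(2, ℤ), γ' ∈ Gamma1 N → ∃! k : Fin (p + 1),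
      Ggl p hp * mapGL ℝ γ' * (mapGL ℝ (rep p X k))⁻¹ * (Ggl p hp)⁻¹ ∈ (Gamma1 N : Subgroup (GL (Fin 2) ℝ)) := by
    intro γ' hγ'
    have h := HeckeTGamma1.existsUnique_option N hp hG hX10 hX11 hX00' (mapGL ℝ γ')
      (Subgroup.mem_map_of_mem _ hγ')
    refine ((idxEquiv p).existsUnique_congr fun k => ?_).mpr h
    rfl
  intro γ hγ
  -- cover: index and `δ` for each `j`
  have hcov : ∀ j : Fin (p + 1), ∃ (k : Fin (p + 1)) (δ : SL(2, ℤ)), δ ∈ Gamma1 N ∧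
      Ggl p hp * mapGL ℝ (rep p X j * γ) * (mapGL ℝ (rep p X k))⁻¹ * (Ggl p hp)⁻¹ ∈ (Gamma1 N : Subgroup (GL (Fin 2) ℝ)) ∧
      heckeMat p σ j * (γ : Matrix (Fin 2) (Fin 2) ℤ) = (δ : Matrix (Fin 2) (Fin 2) ℤ) * heckeMat p σ k := by
    intro j
    obtain ⟨k, hk, -⟩ := hEU (rep p X j * γ) (mul_mem (hrep j) hγ)
    obtain ⟨δ₀, hδ₀, hδ₀eq⟩ := exists_delta_of_mem hp hk
    refine ⟨k, ε j * δ₀ * (ε k)⁻¹, mul_mem (mul_mem (hεΓ j) hδ₀) (inv_mem (hεΓ k)), hk, ?_⟩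
    rw [hfac j, hfac k, Matrix.SpecialLinearGroup.coe_mul, Matrix.SpecialLinearGroup.coe_mul]
    have hEE : (((ε k)⁻¹ : SL(2, ℤ)) : Matrix (Fin 2) (Fin 2) ℤ) * (ε k : Matrix (Fin 2) (Fin 2) ℤ) = 1 := by
      rw [← Matrix.SpecialLinearGroup.coe_mul, inv_mul_cancel, Matrix.SpecialLinearGroup.coe_one]
    calc (ε j : Matrix (Fin 2) (Fin 2) ℤ) * (Gz p * (rep p X j : Matrix (Fin 2) (Fin 2) ℤ)) * (γ : Matrix (Fin 2) (Fin 2) ℤ)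
        = (ε j : Matrix (Fin 2) (Fin 2) ℤ) * (Gz p * ((rep p X j * γ : SL(2, ℤ)) : Matrix (Fin 2) (Fin 2) ℤ)) := by
          rw [Matrix.SpecialLinearGroup.coe_mul]; simp only [Matrix.mul_assoc]
      _ = (ε j : Matrix (Fin 2) (Fin 2) ℤ) * ((δ₀ : Matrix (Fin 2) (Fin 2) ℤ) * (Gz p * (rep p X k : Matrix (Fin 2) (Fin 2) ℤ))) := by
          rw [hδ₀eq]
      _ = (ε j : Matrix (Fin 2) (Fin 2) ℤ) * (δ₀ : Matrix (Fin 2) (Fin 2) ℤ) * (((ε k)⁻¹ : SL(2, ℤ)) : Matrix (Fin 2) (Fin 2) ℤ) *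
            ((ε k : Matrix (Fin 2) (Fin 2) ℤ) * (Gz p * (rep p X k : Matrix (Fin 2) (Fin 2) ℤ))) := by
          simp only [Matrix.mul_assoc]
          rw [← Matrix.mul_assoc (((ε k)⁻¹ : SL(2, ℤ)) : Matrix (Fin 2) (Fin 2) ℤ), hEE, Matrix.one_mul]
  choose kk δ hδΓ hkk hδeq using hcov
  -- injectivity of `j ↦ kk j` by uniqueness
  have hinj : Function.Injective kk := by
    intro j₁ j₂ hj
    have h1 := hkk j₁
    have h2 := hkk j₂
    rw [← hj] at h2
    -- both `idx j₁` and `idx j₂` witness the unique coset of `rep j₁`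
    have hu := hEU (rep p X j₁) (hrep j₁)
    apply hu.unique
    · -- trivially in Γ₁: the element is 1
      have : Ggl p hp * mapGL ℝ (rep p X j₁) * (mapGL ℝ (rep p X j₁))⁻¹ * (Ggl p hp)⁻¹ = 1 := by group
      rw [this]; exact one_mem _
    · -- from h1, h2: `G t₁ γ k⁻¹ G⁻¹`, `G t₂ γ k⁻¹ G⁻¹ ∈ Γ₁` ⟹ `G t₁ t₂⁻¹ G⁻¹ ∈ Γ₁`
      have h12 := mul_mem h1 (inv_mem h2)
      have e : Ggl p hp * mapGL ℝ (rep p X j₁ * γ) * (mapGL ℝ (rep p X (kk j₁)))⁻¹ * (Ggl p hp)⁻¹ *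
          (Ggl p hp * mapGL ℝ (rep p X j₂ * γ) * (mapGL ℝ (rep p X (kk j₁)))⁻¹ * (Ggl p hp)⁻¹)⁻¹ =
          Ggl p hp * mapGL ℝ (rep p X j₁) * (mapGL ℝ (rep p X j₂))⁻¹ * (Ggl p hp)⁻¹ := by
        simp only [map_mul]; group
      rw [e] at h12
      exact h12
  refine ⟨Equiv.ofBijective kk hinj.bijective_of_finite, δ, fun j => ⟨hδΓ j, ?_⟩⟩
  exact hδeq j


end CosetPermutationProof


/-! ## Piece 1 PROVED: `T'_p` preserves the quarter cusp forms -/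

section StableFormsProof

variable {p : ℕ}

/-- `C²` is preserved by composition with the action of `g ∈ GL₂⁺(ℝ)`. -/
theorem isC2_comp_smul {f : ℍ → ℂ} (hf : IsC2 f) {g : GL (Fin 2) ℝ} (hg : 0 < g.det.val) :
    IsC2 (fun w => f (g • w)) := by
  unfold IsC2
  rw [comp_smul_extend_eq]
  refine hf.comp (contDiffOn_smulExtend hg 2) fun z _ => ?_
  exact (g • ofComplex z).im_pos

/-- `T'_p u = Σ_j p^{-1/2} · (u ∘ M_j)` as functions on `ℍ`. (DiamondShurman2005, Prop. 5.2.1) -/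
theorem heckeT_eq_sum (hp : p.Prime) (σ : SL(2, ℤ)) (u : ℍ → ℂ) :
    heckeT p σ u = fun z => ∑ j : Fin (p + 1), ((Real.sqrt p : ℝ) : ℂ)⁻¹ * u (heckeGL σ hp j • z) := by
  funext z
  simp only [← heckeAct_eq_smul σ hp]
  unfold heckeT heckeAct
  rw [← Finset.mul_sum, Fin.sum_univ_castSucc]
  congr 2
  · rw [Finset.sum_range]
    refine Finset.sum_congr rfl fun i _ => ?_
    simp only [Fin.val_castSucc, Fin.is_lt, if_true]
  · simp only [Fin.val_last, lt_self_iff_false, if_false]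

/-- **stub_heckeStableQuarterForms** (registered stub; child `HeckeStableQuarterForms`, crux), PROVED:
`T'_p` maps quarter cusp forms on `Γ₁(N)` to quarter cusp forms — `C²` by composition and sums,
`Γ₁(N)`-invariance by the coset permutation (piece 2), eigenvalue `1/4` by the `GL₂⁺(ℝ)`-invariance
of `Δ`, boundedness directly. (DiamondShurman2005, Prop. 5.2.1) -/
theorem stub_heckeStableQuarterForms : let IsQuarterCuspForm : ℕ → (UpperHalfPlane → ℂ) → Prop := fun N u => Literature.NumberTheory.Automorphic.IsC2 u ∧ (∀ γ ∈ CongruenceSubgroup.Gamma1 N, ∀ z : UpperHalfPlane, u (γ • z) = u z) ∧ (∀ z : UpperHalfPlane, Literature.NumberTheory.Automorphic.hypLaplacian u z + (1 / 4 : ℂ) * u z = 0) ∧ ∃ C : ℝ, ∀ z : UpperHalfPlane, ‖u z‖ ≤ C; ∀ N : ℕ, 0 < N → ∀ p : ℕ, p.Prime → ¬ p ∣ N → ∀ σ ∈ CongruenceSubgroup.Gamma0 N, (((σ : Matrix (Fin 2) (Fin 2) ℤ) 1 1 : ℤ) : ZMod N) = (p : ZMod N) → ∀ u : UpperHalfPlane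 → ℂ, IsQuarterCuspForm N u → IsQuarterCuspForm N (fun z : UpperHalfPlane => ((Real.sqrt p : ℝ) : ℂ)⁻¹ * (∑ b ∈ Finset.range p, u (UpperHalfPlane.ofComplex (((z : ℂ) + b) / p)) + u (σ • UpperHalfPlane.ofComplex ((p : ℂ) * (z : ℂ))))) := by
  intro IsQCF N hN p hp hpN σ hσ hσp u hu
  show IsQuarterCuspFormR N (heckeT p σ u)
  obtain ⟨hC2, hinv, heig, C, hC⟩ := (hu : IsQuarterCuspFormR N u)
  have hX2 : ∀ γ ∈ CongruenceSubgroup.Gamma1 N, ∃ (e : Equiv.Perm (Fin (p + 1)))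
      (δ : Fin (p + 1) → SL(2, ℤ)), ∀ j : Fin (p + 1), δ j ∈ CongruenceSubgroup.Gamma1 N ∧
        heckeMat p σ j * (γ : Matrix (Fin 2) (Fin 2) ℤ) = (δ j : Matrix (Fin 2) (Fin 2) ℤ) * heckeMat p σ (e j) :=
    stub_heckeCosetPermutation N hN p hp hpN σ hσ hσp
  have hsum := heckeT_eq_sum hp σ u
  set c : ℂ := ((Real.sqrt p : ℝ) : ℂ)⁻¹ with hc
  have hC2j : ∀ j : Fin (p + 1), IsC2 (fun w => u (heckeGL σ hp j • w)) := fun j =>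
    isC2_comp_smul hC2 (heckeGL_det_pos σ hp j)
  refine ⟨?_, ?_, ?_, ?_⟩
  · -- `C²`
    rw [hsum]
    exact isC2_finset_sum Finset.univ (fun _ => c) (fun j w => u (heckeGL σ hp j • w)) fun j _ => hC2j j
  · -- `Γ₁(N)`-invariance
    intro γ hγ z
    rw [hsum]
    obtain ⟨e, δ, hδ⟩ := hX2 γ hγ
    have key : ∀ j : Fin (p + 1), u (heckeGL σ hp j • γ • z) = u (heckeGL σ hp (e j) • z) := fun j => by
      rw [sl_smul_eq_mapGL_smul, ← mul_smul, heckeGL_mul_eq σ hp (hδ j).2, mul_smul,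
        ← sl_smul_eq_mapGL_smul, hinv _ (hδ j).1]
    simp only [key]
    exact Fintype.sum_equiv e _ _ fun j => rfl
  · -- eigenvalue `1/4`
    intro z
    rw [hsum, hypLaplacian_finset_sum Finset.univ (fun _ => c) (fun j w => u (heckeGL σ hp j • w))
      (fun j _ => hC2j j) z]
    rw [Finset.mul_sum, ← Finset.sum_add_distrib]
    refine Finset.sum_eq_zero fun j _ => ?_
    have hcd : ContDiffAt ℝ 2 (u ∘ ofComplex) ((heckeGL σ hp j • z : ℍ) : ℂ) :=
      hC2.contDiffAt (isOpen_upperHalfPlaneSet.mem_nhds (heckeGL σ hp j • z).im_pos)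
    rw [hypLaplacian_comp_smul (heckeGL_det_pos σ hp j) u z hcd]
    have h := heig (heckeGL σ hp j • z)
    linear_combination c * h
  · -- boundedness
    refine ⟨‖c‖ * (∑ b ∈ Finset.range p, C + C), fun z => ?_⟩
    show ‖((Real.sqrt p : ℝ) : ℂ)⁻¹ * (∑ b ∈ Finset.range p,
        u (UpperHalfPlane.ofComplex (((z : ℂ) + b) / p)) + u (σ • UpperHalfPlane.ofComplex ((p : ℂ) * (z : ℂ))))‖ ≤ _
    rw [norm_mul]
    refine mul_le_mul_of_nonneg_left ?_ (norm_nonneg _)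
    exact (norm_add_le _ _).trans
      (add_le_add ((norm_sum_le _ _).trans (Finset.sum_le_sum fun b _ => hC _)) (hC _))

end StableFormsProof

end Summit.Langlands.Langlands.Theorems.HeckeRationalPeriods
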